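import Mathlib
import Literature.AlgebraicGeometry.Resolution.CobordantGame
import Literature.AlgebraicGeometry.Resolution.CobordantChartCoefficients
import Literature.AlgebraicGeometry.Resolution.CobordantChartPlaneSlice
import Literature.AlgebraicGeometry.Resolution.AxisPolyhedron
import Summits.ResolutionOfSingularities.ResolutionOfSingularities.Theorems.WeightedInvariantLocalWeightedDropAxisPointMove
import Summits.ResolutionOfSingularities.ResolutionOfSingularities.Theorems.WeightedInvariantLocalWeightedDropAxisPreparationTaylor
import Summits.ResolutionOfSingularities.ResolutionOfSingularities.Theorems.WeightedInvariantLocalWeightedDropAxisWeightedMoveRotate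

/-!
# `LocalWeightedDrop` (stmt-ResolutionOfSingularities-8899), TOT2-LINE piece S-E1 (core, part 1):
# the NEAR point blow-up at the axis point — coefficient dictionary, `δ` drops by exactly one, near iff `δ ≥ 2`

Route `ResolutionOfSingularities/WeightedInvariant`, crux `LocalWeightedDrop`, registered residual
`stub_spaceNCRankDrop` (skeleton v32), sub-line TOT2-LINE v1 §5 (E1) [OURS · L1 W4.3; AI-drafted, weaker than
expert review].  Def-free CORE of the `e = 1` termination (CJS LNM 2270 Thm 5.35 / §9 in local hypersurface
form; the `δ`-bookkeeping is a CJS Lemma 9.3-type computation), in every dimension `n + 1` and over every field.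

**Setting** (the weighted engine's AXIS vocabulary `Literature…AxisPolyhedron`, which is CJS's `e = 1`
dictionary: `u = z = Fin.last n` spans the directrix, `y = x' = Fin.castSucc _`).  `S ∈ k[[x'₁, …, x'ₙ, z]]`,
the point blow-up with all weights `1` at the AXIS POINT `c = (0, …, 0, c_z)`, `c_z ≠ 0`
(chart `x'_j = s y'_j`, `z = s (c_z + y_z)`), `S(chart) = s^d · G`, and the `z`-slot slice
`Sl = G|_{y_z = 0} ∈ k[[s, y']]` (exactly the objects of `AxisPointMove.coeff_axisSlice`).  The NEAR SUCCESSOR in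
axis coordinates is `N := Sl` re-indexed by `(finRotate (n+1)).symm` (`s ↦ z`-slot, `y'_j ↦ x'_j`-slot), so
that the exceptional variable is the new free variable (the rotation of `…AxisWeightedMoveRotate`, a legal
coordinate change: `AxisWeightedMove.won_rename_rot_iff`); it enters every statement through the hypothesis
`hN : N = rename ⇑(finRotate (n+1)).symm Sl`.

**Results of this file** (all elementary consequences of `coeff_axisSlice`: the monomial `x'^b z^γ` of `S`
becomes `c_z^γ · x'^b z^{|b| + γ - d}` of `N`):
* `coeff_nearSucc_update`, `coeff_nearSucc`, `coeff_nearSucc_of_last_eq_zero` — the coefficient dictionary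
  (via `AxisWeightedMove.coeff_rename_rot`; the `z`-free degree-`d` coefficients, i.e. `F(x')`, are unchanged);
* `aboveLevel_nearSucc_iff` — **`AboveLevel d r q N ↔ AboveLevel d (r + q) q S`**: `δ(N) = δ(S) - 1` EXACTLY
  (threshold form; no preparation is needed for this);
* `le_order_nearSucc_iff`, `order_nearSucc_eq` — the successor is NEAR (`ord N = d`) iff `δ(S) ≥ 2` (the
  `δ < 2` half is the computation of `AxisPointMove.order_axisSlice_lt`, stub B3).
Part 2 (`…AxisNearDescent`): transport of `AxisCone` / `TrivialApexX` / `InAxisIdeal` / `Solvable` /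
`PreparedAxis`.
-/

set_option linter.dupNamespace false -- mandated namespace of this single-conjunct summit

namespace Summit.ResolutionOfSingularities.ResolutionOfSingularities.Theorems

open Literature.AlgebraicGeometry.Resolution

namespace AxisNearDescent

open MvPowerSeries AxisPolyhedron

variable {k : Type} [Field k] {n : ℕ}
/-! ### Exponent bookkeeping at the `z`-slot -/

/-- Updating the `z`-exponent does not change the `x'`-degree. -/
theorem xDeg_update_last (E : Fin (n + 1) →₀ ℕ) (r : ℕ) : xDeg (E.update (Fin.last n) r) = xDeg E := by
  unfold xDeg
  refine Finset.sum_congr rfl fun j _ => ?_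
  rw [Finsupp.coe_update, Function.update_of_ne (Fin.castSucc_lt_last j).ne]

/-- The updated `z`-exponent. -/
theorem update_last_apply_last (E : Fin (n + 1) →₀ ℕ) (r : ℕ) :
    (E.update (Fin.last n) r) (Fin.last n) = r := by
  rw [Finsupp.coe_update, Function.update_self]

/-- Updating the `z`-exponent does not change the `x'`-exponents. -/
theorem update_last_apply_castSucc (E : Fin (n + 1) →₀ ℕ) (r : ℕ) (j : Fin n) :
    (E.update (Fin.last n) r) (Fin.castSucc j) = E (Fin.castSucc j) := by
  rw [Finsupp.coe_update, Function.update_of_ne (Fin.castSucc_lt_last j).ne]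

/-- Degree of the updated exponent. -/
theorem degree_update_last (E : Fin (n + 1) →₀ ℕ) (r : ℕ) :
    (E.update (Fin.last n) r).degree = xDeg E + r := by
  rw [AxisPreparation.degree_eq_xDeg_add, xDeg_update_last, update_last_apply_last]

/-- Updating with the current value does nothing. -/
theorem update_last_eq_self {E : Fin (n + 1) →₀ ℕ} {r : ℕ} (h : E (Fin.last n) = r) :
    E.update (Fin.last n) r = E := by
  ext l
  rcases Fin.eq_castSucc_or_eq_last l with ⟨j, rfl⟩ | rfl
  · exact update_last_apply_castSucc E r j
  · rw [update_last_apply_last, h]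

/-- Two successive updates of the `z`-exponent. -/
theorem update_last_update_last (E : Fin (n + 1) →₀ ℕ) (a b : ℕ) :
    (E.update (Fin.last n) a).update (Fin.last n) b = E.update (Fin.last n) b := by
  ext l
  rcases Fin.eq_castSucc_or_eq_last l with ⟨j, rfl⟩ | rfl
  · rw [update_last_apply_castSucc, update_last_apply_castSucc, update_last_apply_castSucc]
  · rw [update_last_apply_last, update_last_apply_last]

/-! ### The coefficient dictionary of the near successor -/

/-- COEFFICIENTS OF THE NEAR SUCCESSOR, source form: the monomial `x'^b z^γ` of `S` (exponent `E₀`,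
`|E₀| ≥ d`) gives the monomial `x'^b z^{|E₀| - d}` of `N` with coefficient `S_{E₀} · c_z^γ`. -/
theorem coeff_nearSucc_update {S : MvPowerSeries (Fin (n + 1)) k} {c : Fin (n + 1) → k}
    (hc : ∀ j : Fin n, c (Fin.castSucc j) = 0) {d : ℕ} {G : MvPowerSeries (Fin (n + 2)) k}
    (hfac : subst (CobordantChart.chart (fun _ : Fin (n + 1) => 1) c) S = X 0 ^ d * G)
    {N : MvPowerSeries (Fin (n + 1)) k}
    (hN : N = rename (⇑(finRotate (n + 1)).symm)
      (subst (fun j : Fin (n + 2) => if j = (Fin.last n).succ then (0 : MvPowerSeries (Fin (n + 1)) k)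
        else X (Fin.predAbove (Fin.last n) j)) G))
    {E₀ : Fin (n + 1) →₀ ℕ} (hd : d ≤ E₀.degree) :
    coeff (E₀.update (Fin.last n) (E₀.degree - d)) N = coeff E₀ S * c (Fin.last n) ^ E₀ (Fin.last n) := by
  rw [hN, AxisWeightedMove.coeff_rename_rot, update_last_apply_last]
  have hx : (Finsupp.equivFunOnFinite.symm fun j : Fin n =>
      (E₀.update (Fin.last n) (E₀.degree - d)) (Fin.castSucc j)) =
      Finsupp.equivFunOnFinite.symm fun j : Fin n => E₀ (Fin.castSucc j) := by
    congr 1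
    funext j
    exact update_last_apply_castSucc E₀ _ j
  rw [hx]
  exact AxisPointMove.coeff_axisSlice hc hfac hd

/-- COEFFICIENTS OF THE NEAR SUCCESSOR, target form: the exponent `E = (b, r)` of `N` (with `|b| ≤ r + d`,
automatic when `|b| ≤ d`) reads the exponent `(b, r + d - |b|)` of `S`, times `c_z^{r + d - |b|}`. -/
theorem coeff_nearSucc {S : MvPowerSeries (Fin (n + 1)) k} {c : Fin (n + 1) → k}
    (hc : ∀ j : Fin n, c (Fin.castSucc j) = 0) {d : ℕ} {G : MvPowerSeries (Fin (n + 2)) k}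
    (hfac : subst (CobordantChart.chart (fun _ : Fin (n + 1) => 1) c) S = X 0 ^ d * G)
    {N : MvPowerSeries (Fin (n + 1)) k}
    (hN : N = rename (⇑(finRotate (n + 1)).symm)
      (subst (fun j : Fin (n + 2) => if j = (Fin.last n).succ then (0 : MvPowerSeries (Fin (n + 1)) k)
        else X (Fin.predAbove (Fin.last n) j)) G))
    {E : Fin (n + 1) →₀ ℕ} (hE : xDeg E ≤ E (Fin.last n) + d) :
    coeff E N = coeff (E.update (Fin.last n) (E (Fin.last n) + d - xDeg E)) S *
      c (Fin.last n) ^ (E (Fin.last n) + d - xDeg E) := by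
  have hdeg : (E.update (Fin.last n) (E (Fin.last n) + d - xDeg E)).degree = E (Fin.last n) + d := by
    rw [degree_update_last]; omega
  have hd : d ≤ (E.update (Fin.last n) (E (Fin.last n) + d - xDeg E)).degree := by rw [hdeg]; omega
  have h := coeff_nearSucc_update hc hfac hN hd
  rw [hdeg, Nat.add_sub_cancel, update_last_update_last, update_last_eq_self rfl,
    update_last_apply_last] at h
  exact h

/-- The `z`-FREE COEFFICIENTS OF DEGREE `d` ARE UNCHANGED (the form `F(x')` survives verbatim). -/
theorem coeff_nearSucc_of_last_eq_zero {S : MvPowerSeries (Fin (n + 1)) k} {c : Fin (n + 1) → k}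
    (hc : ∀ j : Fin n, c (Fin.castSucc j) = 0) {d : ℕ} {G : MvPowerSeries (Fin (n + 2)) k}
    (hfac : subst (CobordantChart.chart (fun _ : Fin (n + 1) => 1) c) S = X 0 ^ d * G)
    {N : MvPowerSeries (Fin (n + 1)) k}
    (hN : N = rename (⇑(finRotate (n + 1)).symm)
      (subst (fun j : Fin (n + 2) => if j = (Fin.last n).succ then (0 : MvPowerSeries (Fin (n + 1)) k)
        else X (Fin.predAbove (Fin.last n) j)) G))
    {E : Fin (n + 1) →₀ ℕ} (hdeg : E.degree = d) (hz : E (Fin.last n) = 0) :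
    coeff E N = coeff E S := by
  have hx : xDeg E = d := by
    have h := AxisPreparation.degree_eq_xDeg_add E
    rw [hdeg, hz, add_zero] at h
    exact h.symm
  rw [coeff_nearSucc hc hfac hN (by rw [hx, hz, zero_add]), hx, hz, zero_add, Nat.sub_self, pow_zero, mul_one,
    update_last_eq_self hz]

/-! ### `δ` drops by exactly one -/

/-- **`δ(N) = δ(S) - 1`, threshold form**: `δ(N; x'; z) ≥ r/q ↔ δ(S; x'; z) ≥ (r + q)/q`, for a source of
order `≥ d` (every monomial of `S` has degree `≥ d`) and `c_z ≠ 0`. -/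
theorem aboveLevel_nearSucc_iff {S : MvPowerSeries (Fin (n + 1)) k} {c : Fin (n + 1) → k}
    (hc : ∀ j : Fin n, c (Fin.castSucc j) = 0) (hcz : c (Fin.last n) ≠ 0) {d : ℕ}
    {G : MvPowerSeries (Fin (n + 2)) k}
    (hfac : subst (CobordantChart.chart (fun _ : Fin (n + 1) => 1) c) S = X 0 ^ d * G)
    {N : MvPowerSeries (Fin (n + 1)) k}
    (hN : N = rename (⇑(finRotate (n + 1)).symm)
      (subst (fun j : Fin (n + 2) => if j = (Fin.last n).succ then (0 : MvPowerSeries (Fin (n + 1)) k)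
        else X (Fin.predAbove (Fin.last n) j)) G))
    (hord : ∀ E : Fin (n + 1) →₀ ℕ, coeff E S ≠ 0 → d ≤ E.degree) (r q : ℕ) :
    AboveLevel d r q N ↔ AboveLevel d (r + q) q S := by
  constructor
  · intro h E₀ hx₀ hlt₀
    by_contra hne
    have hd := hord E₀ hne
    have hdeg := AxisPreparation.degree_eq_xDeg_add E₀
    have hzero := h (E₀.update (Fin.last n) (E₀.degree - d)) (by rw [xDeg_update_last]; exact hx₀)
      (by rw [xDeg_update_last, update_last_apply_last]
          have h1 : q * (E₀.degree - d) + q * (d - xDeg E₀) = q * E₀ (Fin.last n) := by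
            rw [← Nat.mul_add]; congr 1; omega
          have h2 : (r + q) * (d - xDeg E₀) = r * (d - xDeg E₀) + q * (d - xDeg E₀) := Nat.add_mul _ _ _
          omega)
    rw [coeff_nearSucc_update hc hfac hN hd] at hzero
    exact mul_ne_zero hne (pow_ne_zero _ hcz) hzero
  · intro h E hx hlt
    rw [coeff_nearSucc hc hfac hN (by omega), h _ (by rw [xDeg_update_last]; exact hx) ?_, zero_mul]
    rw [xDeg_update_last, update_last_apply_last]
    have : q * (E (Fin.last n) + d - xDeg E) = q * E (Fin.last n) + q * (d - xDeg E) := by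
      rw [← Nat.mul_add]; congr 1; omega
    rw [this, Nat.add_mul]
    exact Nat.add_lt_add_right hlt _

/-! ### The successor is near iff `δ(S) ≥ 2` -/

/-- `δ(S) ≥ 2` forces `ord N ≥ d`. -/
theorem le_order_nearSucc {S : MvPowerSeries (Fin (n + 1)) k} {c : Fin (n + 1) → k}
    (hc : ∀ j : Fin n, c (Fin.castSucc j) = 0) {d : ℕ} {G : MvPowerSeries (Fin (n + 2)) k}
    (hfac : subst (CobordantChart.chart (fun _ : Fin (n + 1) => 1) c) S = X 0 ^ d * G)
    {N : MvPowerSeries (Fin (n + 1)) k}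
    (hN : N = rename (⇑(finRotate (n + 1)).symm)
      (subst (fun j : Fin (n + 2) => if j = (Fin.last n).succ then (0 : MvPowerSeries (Fin (n + 1)) k)
        else X (Fin.predAbove (Fin.last n) j)) G))
    (hlev : AboveLevel d 2 1 S) : (d : ℕ∞) ≤ N.order := by
  refine MvPowerSeries.nat_le_order fun E hElt => ?_
  have hdeg := AxisPreparation.degree_eq_xDeg_add E
  have hElt' : E.degree < d := by exact_mod_cast hElt
  rw [coeff_nearSucc hc hfac hN (by omega), hlev _ (by rw [xDeg_update_last]; omega) ?_, zero_mul]
  rw [xDeg_update_last, update_last_apply_last]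
  omega

/-- `δ(S) < 2` forces `ord N < d` (for a source of order `≥ d` and `c_z ≠ 0`; cf.
`AxisPointMove.order_axisSlice_lt` for the un-re-indexed slice). -/
theorem order_nearSucc_lt {S : MvPowerSeries (Fin (n + 1)) k} {c : Fin (n + 1) → k}
    (hc : ∀ j : Fin n, c (Fin.castSucc j) = 0) (hcz : c (Fin.last n) ≠ 0) {d : ℕ}
    {G : MvPowerSeries (Fin (n + 2)) k}
    (hfac : subst (CobordantChart.chart (fun _ : Fin (n + 1) => 1) c) S = X 0 ^ d * G)
    {N : MvPowerSeries (Fin (n + 1)) k}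
    (hN : N = rename (⇑(finRotate (n + 1)).symm)
      (subst (fun j : Fin (n + 2) => if j = (Fin.last n).succ then (0 : MvPowerSeries (Fin (n + 1)) k)
        else X (Fin.predAbove (Fin.last n) j)) G))
    (hord : ∀ E : Fin (n + 1) →₀ ℕ, coeff E S ≠ 0 → d ≤ E.degree) (hlev : ¬ AboveLevel d 2 1 S) :
    N.order < (d : ℕ∞) := by
  obtain ⟨E₀, hx₀, hlt₀, hne⟩ : ∃ E₀ : Fin (n + 1) →₀ ℕ, xDeg E₀ < d ∧
      1 * E₀ (Fin.last n) < 2 * (d - xDeg E₀) ∧ coeff E₀ S ≠ 0 := by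
    by_contra hno
    push Not at hno
    exact hlev hno
  have hd := hord E₀ hne
  have hdeg := AxisPreparation.degree_eq_xDeg_add E₀
  have hcoef := coeff_nearSucc_update hc hfac hN hd
  have hne' : coeff (E₀.update (Fin.last n) (E₀.degree - d)) N ≠ 0 := by
    rw [hcoef]; exact mul_ne_zero hne (pow_ne_zero _ hcz)
  refine lt_of_le_of_lt (MvPowerSeries.order_le hne') ?_
  rw [degree_update_last]
  exact_mod_cast (show xDeg E₀ + (E₀.degree - d) < d by omega)

/-- **THE SUCCESSOR AT THE AXIS POINT IS NEAR IFF `δ(S) ≥ 2`**: `d ≤ ord N ↔ AboveLevel d 2 1 S`. -/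
theorem le_order_nearSucc_iff {S : MvPowerSeries (Fin (n + 1)) k} {c : Fin (n + 1) → k}
    (hc : ∀ j : Fin n, c (Fin.castSucc j) = 0) (hcz : c (Fin.last n) ≠ 0) {d : ℕ}
    {G : MvPowerSeries (Fin (n + 2)) k}
    (hfac : subst (CobordantChart.chart (fun _ : Fin (n + 1) => 1) c) S = X 0 ^ d * G)
    {N : MvPowerSeries (Fin (n + 1)) k}
    (hN : N = rename (⇑(finRotate (n + 1)).symm)
      (subst (fun j : Fin (n + 2) => if j = (Fin.last n).succ then (0 : MvPowerSeries (Fin (n + 1)) k)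
        else X (Fin.predAbove (Fin.last n) j)) G))
    (hord : ∀ E : Fin (n + 1) →₀ ℕ, coeff E S ≠ 0 → d ≤ E.degree) :
    (d : ℕ∞) ≤ N.order ↔ AboveLevel d 2 1 S := by
  constructor
  · intro h
    by_contra hlev
    exact absurd h (not_le_of_gt (order_nearSucc_lt hc hcz hfac hN hord hlev))
  · exact le_order_nearSucc hc hfac hN

/-- A series of order `d` has all its monomials in degree `≥ d` (the shape of `hord` above). -/
theorem le_degree_of_coeff_ne_zero {S : MvPowerSeries (Fin (n + 1)) k} {d : ℕ} (hSd : S.order = d)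
    (E : Fin (n + 1) →₀ ℕ) (hE : coeff E S ≠ 0) : d ≤ E.degree := by
  by_contra hlt
  push Not at hlt
  exact hE (MvPowerSeries.coeff_of_lt_order (by rw [hSd]; exact_mod_cast hlt))

/-- **ORDER OF THE NEAR SUCCESSOR**: for an axis germ `S` of order `d` (`AxisCone`: `in_d S = F(x') ≠ 0`) with
`δ(S) ≥ 2`, the successor at the axis point has order exactly `d`. -/
theorem order_nearSucc_eq {S : MvPowerSeries (Fin (n + 1)) k} {c : Fin (n + 1) → k}
    (hc : ∀ j : Fin n, c (Fin.castSucc j) = 0) {d : ℕ}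
    {G : MvPowerSeries (Fin (n + 2)) k}
    (hfac : subst (CobordantChart.chart (fun _ : Fin (n + 1) => 1) c) S = X 0 ^ d * G)
    {N : MvPowerSeries (Fin (n + 1)) k}
    (hN : N = rename (⇑(finRotate (n + 1)).symm)
      (subst (fun j : Fin (n + 2) => if j = (Fin.last n).succ then (0 : MvPowerSeries (Fin (n + 1)) k)
        else X (Fin.predAbove (Fin.last n) j)) G))
    (hSd : S.order = d) (hcone : AxisCone d S) (hlev : AboveLevel d 2 1 S) : N.order = d := by
  refine le_antisymm ?_ (le_order_nearSucc hc hfac hN hlev)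
  obtain ⟨⟨E₀, hne, hdeg⟩, -⟩ := MvPowerSeries.order_eq_nat.mp hSd
  have hz : E₀ (Fin.last n) = 0 := by
    by_contra hz
    exact hne (hcone E₀ hdeg hz)
  have h := coeff_nearSucc_of_last_eq_zero hc hfac hN hdeg hz
  have hne' : coeff E₀ N ≠ 0 := by rw [h]; exact hne
  have := MvPowerSeries.order_le hne'
  rw [hdeg] at this
  exact this

end AxisNearDescent

end Summit.ResolutionOfSingularities.ResolutionOfSingularities.Theorems
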